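import Literature.MathematicalPhysics.QuantumFieldTheory.Balaban1983to89.B5Projector144Exists

/-! # `Balaban1983to89.B5Projector144Torus` — B5 Sect. C on the TYPED TORUS: the printed structural facts of
p. 22 DISCHARGED for the torus operators of the b05 chain, so that Δ⁻¹, G′_k, (Q′_kG′_k²Q′_k*)⁻¹, (Q′_kΔ⁻²Q′_k*)⁻¹
EXIST for them with no free hypothesis and the orthogonal projection onto ΔN(Q′_k) of `B5GaussSectC` §7 IS the
printed (1.44) / (1.38) (unit b2b-balaban-b05-g13, node 7; v1.1 adds §7: the PRINTED adjoint Q′_k* for the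
η^d-weighted product, XREAD C-adv6-106 (β))

CITATION HEADER. T. Bałaban, *Propagators and renormalization transformations for lattice gauge theories. I*,
Commun. Math. Phys. 95 (1984) 17–40 [`Balaban1984PropagatorsI`], Sect. C pp. 20–25 [PDF 4–9] (transcriptions of
`B5Projector144`, `B5GaussSectC`, `B5Projector144Exists`; no new page read). Cell pub-balaban, paper sub-cell B05.

WHAT IS PRINTED.  p. 20 (1.20): «(Q′_kλ)(y) = Σ_{x∈B^k(y)} η^dλ(x)».  p. 22 [PDF 6]: «the Laplace operator Δ on the
torus T_η … is a symmetric, non-negative operator, and 0 is its eigenvalue. Constant functions form the eigenspace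
corresponding to the eigenvalue 0, and on the subspace orthogonal to constant functions the operator Δ is positive.
… the operator Q′_k transforms constant functions on the η-lattice into constant functions on the unit lattice, and
similarly for the orthogonal subspaces. This implies the corresponding property for Q′_k*».  p. 25 [PDF 9]: «with
a > 0 … Δ′_a = Δ + aQ′_k*Q′_k … Now all the operators appearing in these formulas are well defined … if …
‖G′_kQ′_k*ω‖² = 0, then Q′_k*ω = 0, hence ω = 0.»

TYPING = the torus model of `B5GaussSectC` §7 (its conventions D-b05g13.3): `L2T n M` = real functions on the fine
torus `Tor (fine n M)` (T_η, η = n⁻¹ = L^{−k}) with the (unweighted) Euclidean inner product Σ_x u(x)v(x);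
`L2B M` = real functions on the block torus `Tor M` (T₁^(k)); Δ = `DeltaT n M c` = re∘`LapS (fine n M) c` (c ≠ 0 the
lattice-spacing parameter of `B5Action121`); Q′_k = `QT` = re∘`QsOp n M` (the block AVERAGE (1.20)); Q′_k* = `QsT`
= its TRANSPOSE, i.e. the adjoint for the unweighted inner products = η^d × the printed Q′_k*, which is the adjoint
for the η^d-weighted L²(T_η) of (1.21) and is TYPED in §7 (v1.1) as `QsW := η^{−d}•QsT`: (Q′_k*φ)(x) = φ(y(x))
(`QsW_apply`), Q′_kQ′_k* = I (`QT_QsW`), ⟨Q′_kf, φ⟩ = ⟨f, Q′_k*φ⟩_{η} (`QT_adj_weighted`); under Q′_k* ↦ tQ′_k* the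
bundle `GreenData` and (1.38)/(1.43)/(1.44) move the factor into a ↦ ta, (Q′_kG′_k²Q′_k*)⁻¹, (Q′_kΔ⁻²Q′_k*)⁻¹
(`greenData_rescale`, `R144_rescale`, `R138_rescale`), so R — an orthogonal projection — is the same operator
written with either adjoint (`Rop_torus_eq_R144_printedAdjoint`, `exists_R138_printedAdjoint`);
1 = `oneT`, 1′ = `oneB` the constant functions 1.

WHAT THIS FILE CERTIFIES (kernel, no `sorry`; closes the «torus instantiation» NOT-CERTIFIED items of GAPS
C-b05g13-3, -4, -5; NOT summit progress).  The hypotheses of `B5Projector144Exists.exists_all_printed` HOLD for the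
typed torus operators: `DeltaT_symm` («symmetric», from `B5LaplaceSpectral.LapS_isHermitian`), `DeltaT_nonneg`
(«non-negative», `form_LapS_nonneg`), `DeltaT_posK` («on the subspace orthogonal to constant functions … positive»,
`LapS_pos`, c ≠ 0), `DeltaT_oneT` (Δ1 = 0, `LapS_const`), `QT_adj` (transpose = adjoint), `QT_oneT` (Q′_k1 = 1′,
`B5Substitution125.QsOp_const`), `QT_perp` («similarly for the orthogonal subspaces», `QsOp_orth`), `oneB_ne_zero`,
`QsT_injective` («Q′_k*ω = 0, hence ω = 0», `QsOp_adjoint_injective`) — all through the real/complex bridge of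
`B5RealFields` (`IsReal.cplx_mulVec`, `star_cplx_dotProduct`).  Hence `exists_all_torus`: for every c ≠ 0 and a > 0
there EXIST Δ⁻¹, G′_k, (Q′_kG′_k²Q′_k*)⁻¹, (Q′_kΔ⁻²Q′_k*)⁻¹ on the torus satisfying reader A's `LapData` ∧ `AvgData` ∧
`GreenData` ∧ `hci` (`B5Projector144`), and the concrete orthogonal projection
`B5GaussSectC.Rop (NQ n M) (DeltaT n M c)` onto ΔN(Q′_k) (`ker_QT` : N(Q′_k) = `NQ n M`) equals the printed (1.44)
on L²(T_η) and (1.38) on 1^⊥; §6 then restates the torus Gaussian identities of `B5GaussSectC` §7 /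
`B5GaussSectCR144` §3 with the printed R and NO free hypothesis: (1.39) (`calG_torus_eq_R144`, `calG_torus_eq_R138`),
(1.27) = (1.28) = (1.39) (`calG_eq_127_torus_R144`), (1.46) (`integral_146_torus_R144`).  v1.1, §7 (XREAD
C-adv6-106 (β), whose reader kernel-checked the three rescale identities first): §7a the rescale algebra
(`greenData_rescale`/`greenData_unrescale`, `P144_rescale`, `R144_rescale`, `lambda0_rescale`, `P138_rescale`,
`R138_rescale`, `rightInv138_rescale`, `Rop_eq_R144_rescaled`), §7b the printed adjoint `QsW` on the torus
(`QsW_apply`, `QT_adj_weighted`, `QT_QsW`) and §5/§6 rewritten with it: `Rop_torus_eq_R144_printedAdjoint` and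
`Rop_torus_eq_R144_of_greenData` (∀-forms, no c ≠ 0), `exists_R144_printedAdjoint` (c ≠ 0, every printed a > 0),
`calG_torus_eq_R144_printedAdjoint` ((1.39)), `exists_R138_printedAdjoint` ((1.38) on 1^⊥).

NOT CERTIFIED: the bound «≤ a⁻²» (GAPS G-B5-13); the normalisation of `LapS (fine n M) c` against print's Δ = ∂*∂ on
T_η (c is a free non-zero parameter, conventions D-b05g13.3); anything quantitative from [2].

TAGS: [cite: Balaban1984PropagatorsI, p.22] etc. on the statements matching printed sentences; [folklore] on the
real/complex and `EuclideanSpace` bookkeeping. -/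

noncomputable section

open Module
open scoped InnerProductSpace Matrix ComplexConjugate

open Literature.MathematicalPhysics.QuantumFieldTheory.Balaban1983to89.B5Projector144
open Literature.MathematicalPhysics.QuantumFieldTheory.Balaban1983to89.B5Projector144Exists (exists_all_printed)
open Literature.MathematicalPhysics.QuantumFieldTheory.Balaban1983to89.B5GaussSectC (Rop L2T DeltaT NQ
  ofLp_DeltaT calG ZN gaussW detN Rsub)
open Literature.MathematicalPhysics.QuantumFieldTheory.Balaban1983to89.B5GaussSectCR144 (calG_eq_R144
  calG_eq_127_printed integral_146_R144 calG_eq_R138 Rop_eq_R144)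
open Literature.MathematicalPhysics.QuantumFieldTheory.Balaban1983to89.B5Prop11Plancherel (Tor fine)
open Literature.MathematicalPhysics.QuantumFieldTheory.Balaban1983to89.B5Action121 (LapS)
open Literature.MathematicalPhysics.QuantumFieldTheory.Balaban1983to89.B5Block118 (QsOp)
open Literature.MathematicalPhysics.QuantumFieldTheory.Balaban1983to89.B5RealFields (reM cplx IsReal
  cplx_eq_zero_iff cplx_apply)

namespace Literature.MathematicalPhysics.QuantumFieldTheory.Balaban1983to89.B5Projector144Torus

/-! ## §1 Real/complex and `EuclideanSpace` bookkeeping -/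

/-- The real inner product of `EuclideanSpace ℝ ι` is the dot product. [folklore] -/
theorem inner_eq_dot {ι : Type*} [Fintype ι] (x y : EuclideanSpace ℝ ι) :
    inner ℝ x y = WithLp.ofLp x ⬝ᵥ WithLp.ofLp y := by
  rw [EuclideanSpace.inner_eq_star_dotProduct, star_trivial, dotProduct_comm]

/-- ⟨u, Aᵀv⟩ = ⟨Au, v⟩ for real matrices. [folklore] -/
theorem dot_transpose_mulVec {m k : Type*} [Fintype m] [Fintype k] (A : Matrix m k ℝ) (u : k → ℝ)
    (v : m → ℝ) : u ⬝ᵥ (Aᵀ *ᵥ v) = (A *ᵥ u) ⬝ᵥ v := by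
  rw [Matrix.mulVec_transpose, dotProduct_comm u, ← Matrix.dotProduct_mulVec, dotProduct_comm]

/-- The complexification `cplx` of real vectors is injective. [folklore] -/
theorem cplx_injective {m : Type*} : Function.Injective (cplx : (m → ℝ) → m → ℂ) := by
  intro u v h
  funext i
  have h' := congrFun h i
  rw [cplx_apply, cplx_apply, Complex.ofReal_inj] at h'
  exact h'

/-- `cplx 1 = 1`. [folklore] -/
theorem cplx_one {m : Type*} : cplx (fun _ : m => (1 : ℝ)) = fun _ => (1 : ℂ) := by
  funext i; rw [cplx_apply, Complex.ofReal_one]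

/-- Σ_i (u_i : ℂ) = (Σ_i u_i : ℝ). [folklore] -/
theorem sum_cplx {m : Type*} [Fintype m] (u : m → ℝ) : ∑ i, cplx u i = ((∑ i, u i : ℝ) : ℂ) := by
  rw [Complex.ofReal_sum]; rfl

variable {d : ℕ} (n : ℕ) [NeZero n] (M : Fin d → ℕ) [hM : ∀ μ, NeZero (M μ)]

/-! ## §2 The typed torus operators -/

/-- Real functions on the block torus T₁^(k) (index `Tor M`), Euclidean inner product.
[cite: Balaban1984PropagatorsI, p.20] -/
abbrev L2B : Type := EuclideanSpace ℝ (Tor M)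

/-- The constant function 1 on T_η. [folklore] -/
def oneT : L2T n M := WithLp.toLp 2 fun _ => 1

/-- The constant function 1′ on T₁^(k). [folklore] -/
def oneB : L2B M := WithLp.toLp 2 fun _ => 1

/-- Q′_k (1.20) on real fields: the real matrix re∘`QsOp n M`. [cite: Balaban1984PropagatorsI, (1.20) p.20] -/
def QT : L2T n M →ₗ[ℝ] L2B M :=
  Matrix.toEuclideanLin (reM (QsOp n M))

/-- Q′_k* := the transpose of re∘`QsOp n M` (adjoint of `QT` for the Euclidean inner products).
[cite: Balaban1984PropagatorsI, p.22] -/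
def QsT : L2B M →ₗ[ℝ] L2T n M :=
  Matrix.toEuclideanLin (reM (QsOp n M))ᵀ

/-- Unfolding of `QT`. [folklore] -/
theorem ofLp_QT (x : L2T n M) : WithLp.ofLp (QT n M x) = reM (QsOp n M) *ᵥ WithLp.ofLp x := rfl

omit [NeZero n] in
/-- Unfolding of `QsT`. [folklore] -/
theorem ofLp_QsT (φ : L2B M) : WithLp.ofLp (QsT n M φ) = (reM (QsOp n M))ᵀ *ᵥ WithLp.ofLp φ := rfl

/-- N(Q′_k) of `B5GaussSectC` §7 is the kernel of `QT`. [folklore] -/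
theorem ker_QT : LinearMap.ker (QT n M) = NQ n M := rfl

/-- ⟨1, x⟩ = Σ_x x(x). [folklore] -/
theorem inner_oneT (x : L2T n M) : inner ℝ (oneT n M) x = ∑ i, WithLp.ofLp x i := by
  rw [inner_eq_dot, oneT, WithLp.ofLp_toLp]
  simp [dotProduct]

/-- ⟨1′, φ⟩ = Σ_y φ(y). [folklore] -/
theorem inner_oneB (φ : L2B M) : inner ℝ (oneB M) φ = ∑ y, WithLp.ofLp φ y := by
  rw [inner_eq_dot, oneB, WithLp.ofLp_toLp]
  simp [dotProduct]

/-! ## §3 The printed structural facts of p. 22 for the torus Laplacian -/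

/-- re∘Δ is a real symmetric matrix (`LapS` Hermitian). [folklore] -/
theorem isHermitian_reM_LapS (c : ℝ) : (reM (LapS (fine n M) (c : ℂ))).IsHermitian := by
  rw [Matrix.IsHermitian, Matrix.conjTranspose_eq_transpose_of_trivial,
    B5RealFields.reM_transpose_of_isHermitian (B5LaplaceSpectral.LapS_isHermitian (fine n M) (c : ℂ))]

/-- «Δ … is a symmetric … operator». [cite: Balaban1984PropagatorsI, p.22] -/
theorem DeltaT_symm (c : ℝ) (x y : L2T n M) : inner ℝ (DeltaT n M c x) y = inner ℝ x (DeltaT n M c y) :=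
  (Matrix.isSymmetric_toEuclideanLin_iff.mpr (isHermitian_reM_LapS n M c)) x y

/-- ⟨Δx, y⟩ as a dot product. [folklore] -/
theorem inner_DeltaT (c : ℝ) (x y : L2T n M) :
    inner ℝ (DeltaT n M c x) y = (reM (LapS (fine n M) (c : ℂ)) *ᵥ WithLp.ofLp x) ⬝ᵥ WithLp.ofLp y := by
  rw [inner_eq_dot, ofLp_DeltaT]

/-- The complex quadratic form of `LapS` on a real field is the real one. [folklore] -/
theorem form_cplx_LapS (c : ℝ) (u : Tor (fine n M) → ℝ) :
    star (cplx u) ⬝ᵥ (LapS (fine n M) (c : ℂ) *ᵥ cplx u) =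
      (((reM (LapS (fine n M) (c : ℂ)) *ᵥ u) ⬝ᵥ u : ℝ) : ℂ) := by
  rw [← (B5RealFields.isReal_LapS (fine n M) (Complex.conj_ofReal c)).cplx_mulVec,
    B5RealFields.star_cplx_dotProduct, dotProduct_comm]

/-- «non-negative operator»: 0 ≤ ⟨Δx, x⟩. [cite: Balaban1984PropagatorsI, p.22] -/
theorem DeltaT_nonneg (c : ℝ) (x : L2T n M) : 0 ≤ inner ℝ (DeltaT n M c x) x := by
  rw [inner_DeltaT, ← Complex.zero_le_real, ← form_cplx_LapS]
  exact B5LaplaceSpectral.form_LapS_nonneg (fine n M) (c : ℂ) _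

/-- «on the subspace orthogonal to constant functions the operator Δ is positive» (c ≠ 0).
[cite: Balaban1984PropagatorsI, p.22] -/
theorem DeltaT_posK {c : ℝ} (hc : c ≠ 0) (x : L2T n M) (hx : inner ℝ (oneT n M) x = 0) (hne : x ≠ 0) :
    0 < inner ℝ (DeltaT n M c x) x := by
  rw [inner_DeltaT, ← Complex.zero_lt_real, ← form_cplx_LapS]
  have hcC : (c : ℂ) ≠ 0 := by exact_mod_cast hc
  refine B5LaplaceSpectral.LapS_pos (fine n M) hcC (cplx (WithLp.ofLp x)) ?_ ?_
  · rw [sum_cplx, ← inner_oneT, hx, Complex.ofReal_zero]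
  · intro h0
    exact hne ((WithLp.ofLp_eq_zero 2).mp ((cplx_eq_zero_iff _).mp h0))

/-- «Constant functions form the eigenspace corresponding to the eigenvalue 0»: Δ1 = 0.
[cite: Balaban1984PropagatorsI, p.22] -/
theorem DeltaT_oneT (c : ℝ) : DeltaT n M c (oneT n M) = 0 := by
  have h : reM (LapS (fine n M) (c : ℂ)) *ᵥ (fun _ => (1 : ℝ)) = 0 := by
    rw [← cplx_eq_zero_iff, (B5RealFields.isReal_LapS (fine n M) (Complex.conj_ofReal c)).cplx_mulVec,
      cplx_one]
    exact B5LaplaceSpectral.LapS_const (fine n M) (c : ℂ) 1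
  apply (WithLp.ofLp_eq_zero 2).mp
  rw [ofLp_DeltaT, oneT, WithLp.ofLp_toLp, h]

/-! ## §4 The printed structural facts of p. 22 for the block average Q′_k and Q′_k* -/

/-- Q′_k* = the adjoint of Q′_k: ⟨Q′_kx, φ⟩ = ⟨x, Q′_k*φ⟩. [cite: Balaban1984PropagatorsI, p.22] -/
theorem QT_adj (x : L2T n M) (φ : L2B M) : inner ℝ (QT n M x) φ = inner ℝ x (QsT n M φ) := by
  rw [inner_eq_dot, inner_eq_dot, ofLp_QT, ofLp_QsT, dot_transpose_mulVec]

/-- «the operator Q′_k transforms constant functions on the η-lattice into constant functions on the unit lattice»: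
Q′_k1 = 1′. [cite: Balaban1984PropagatorsI, p.22] -/
theorem QT_oneT : QT n M (oneT n M) = oneB M := by
  have h : reM (QsOp n M) *ᵥ (fun _ => (1 : ℝ)) = fun _ => 1 := by
    apply cplx_injective
    rw [(B5RealFields.isReal_QsOp n M).cplx_mulVec, cplx_one]
    exact B5Substitution125.QsOp_const n M 1
  apply WithLp.ofLp_injective 2
  rw [ofLp_QT, oneT, oneB, WithLp.ofLp_toLp, WithLp.ofLp_toLp, h]

/-- «and similarly for the orthogonal subspaces»: ⟨1, x⟩ = 0 ⟹ ⟨1′, Q′_kx⟩ = 0.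
[cite: Balaban1984PropagatorsI, p.22] -/
theorem QT_perp (x : L2T n M) (hx : inner ℝ (oneT n M) x = 0) : inner ℝ (oneB M) (QT n M x) = 0 := by
  rw [inner_oneB, ofLp_QT]
  rw [inner_oneT] at hx
  have h := B5Substitution125.QsOp_orth n M (cplx (WithLp.ofLp x))
    (by rw [sum_cplx, hx, Complex.ofReal_zero])
  rw [← (B5RealFields.isReal_QsOp n M).cplx_mulVec, sum_cplx, Complex.ofReal_eq_zero] at h
  exact h

omit [NeZero n] hM in
/-- 1′ ≠ 0 (the block torus is non-empty). [folklore] -/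
theorem oneB_ne_zero : oneB M ≠ 0 := by
  intro h
  have h0 := congrArg (fun v : L2B M => WithLp.ofLp v (0 : Tor M)) h
  simp [oneB] at h0

/-- «Q′_k*ω = 0, hence ω = 0»: Q′_k* is injective. [cite: Balaban1984PropagatorsI, p.25] -/
theorem QsT_injective : Function.Injective (QsT n M) := by
  rw [injective_iff_map_eq_zero]
  intro φ hφ
  have h' : reM (QsOp n M)ᴴ *ᵥ WithLp.ofLp φ = 0 := by
    rw [B5RealFields.reM_conjTranspose, ← ofLp_QsT, hφ, WithLp.ofLp_zero]
  have hc : (QsOp n M)ᴴ *ᵥ cplx (WithLp.ofLp φ) = 0 := by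
    rw [← (B5RealFields.isReal_QsOp n M).conjTranspose.cplx_mulVec, h']
    exact (cplx_eq_zero_iff _).mpr rfl
  have h0 := B5Substitution125.QsOp_adjoint_injective n M _ hc
  exact (WithLp.ofLp_eq_zero 2).mp ((cplx_eq_zero_iff _).mp h0)

/-! ## §5 Everything at once on the torus -/

/-- **Sect. C on the typed torus with NO free hypothesis.** For every lattice parameter c ≠ 0 and every a > 0 there
EXIST Δ⁻¹, G′_k = (Δ + aQ′_k*Q′_k)⁻¹, (Q′_kG′_k²Q′_k*)⁻¹ and (Q′_kΔ⁻²Q′_k*)⁻¹ for the torus operators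
(`DeltaT n M c`, `QT n M`, `QsT n M`) satisfying ALL of reader A's hypotheses `LapData`, `AvgData`, `GreenData`, `hci`
of `B5Projector144`; consequently the orthogonal projection `B5GaussSectC.Rop (NQ n M) (DeltaT n M c)` onto ΔN(Q′_k)
— the R of every torus statement of `B5GaussSectC` §7 — IS the printed (1.44) on L²(T_η) and the printed (1.38) on
1^⊥. [cite: Balaban1984PropagatorsI, p.22+p.25, (1.38), (1.44)] -/
theorem exists_all_torus {c : ℝ} (hc : c ≠ 0) {a : ℝ} (ha : 0 < a) :
    ∃ (Δi g : L2T n M →ₗ[ℝ] L2T n M) (c₂ ci : L2B M →ₗ[ℝ] L2B M),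
      LapData (oneT n M) (DeltaT n M c) Δi ∧ AvgData (oneT n M) (oneB M) (QT n M) (QsT n M) ∧
      GreenData (DeltaT n M c) (QT n M) (QsT n M) a g c₂ ∧
      (∀ φ : L2B M, inner ℝ (oneB M) φ = 0 → QT n M (Δi (Δi (QsT n M (ci φ)))) = φ) ∧
      (∀ f : L2T n M, Rop (NQ n M) (DeltaT n M c) f = R144 (QT n M) (QsT n M) g c₂ f) ∧
      ∀ f : L2T n M, inner ℝ (oneT n M) f = 0 →
        Rop (NQ n M) (DeltaT n M c) f = R138 Δi (QT n M) (QsT n M) ci f :=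
  exists_all_printed (DeltaT_symm n M c) (DeltaT_nonneg n M c) (DeltaT_posK n M hc) (DeltaT_oneT n M c)
    (QT_adj n M) (QT_oneT n M) (QT_perp n M) (oneB_ne_zero M) (QsT_injective n M) ha

/-- In particular reader A's three printed-input bundles are JOINTLY inhabited by the torus operators (a
non-degenerate instance of `B5Projector144.hypotheses_satisfiable`). [cite: Balaban1984PropagatorsI, p.22+p.25] -/
theorem bundles_inhabited_torus {c : ℝ} (hc : c ≠ 0) {a : ℝ} (ha : 0 < a) :
    ∃ (Δi g : L2T n M →ₗ[ℝ] L2T n M) (c₂ : L2B M →ₗ[ℝ] L2B M),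
      LapData (oneT n M) (DeltaT n M c) Δi ∧ AvgData (oneT n M) (oneB M) (QT n M) (QsT n M) ∧
      GreenData (DeltaT n M c) (QT n M) (QsT n M) a g c₂ := by
  obtain ⟨Δi, g, c₂, _, hΔ, hQ, hG, -, -, -⟩ := exists_all_torus n M hc ha
  exact ⟨Δi, g, c₂, hΔ, hQ, hG⟩

/-- The concrete R of `B5GaussSectC` §7 is the printed (1.44) for SOME G′_k, (Q′_kG′_k²Q′_k*)⁻¹ satisfying
`GreenData` (c ≠ 0; a > 0 arbitrary). [cite: Balaban1984PropagatorsI, (1.44) p.25] -/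
theorem Rop_torus_eq_R144 {c : ℝ} (hc : c ≠ 0) {a : ℝ} (ha : 0 < a) :
    ∃ (g : L2T n M →ₗ[ℝ] L2T n M) (c₂ : L2B M →ₗ[ℝ] L2B M),
      GreenData (DeltaT n M c) (QT n M) (QsT n M) a g c₂ ∧
      ∀ f : L2T n M, Rop (NQ n M) (DeltaT n M c) f = R144 (QT n M) (QsT n M) g c₂ f := by
  obtain ⟨_, g, c₂, _, -, -, hG, -, hR, -⟩ := exists_all_torus n M hc ha
  exact ⟨g, c₂, hG, hR⟩

omit [NeZero n] hM in
/-- 1 ≠ 0 on T_η (the fine torus is non-empty). [folklore] -/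
theorem oneT_ne_zero : oneT n M ≠ 0 := by
  intro h
  have h0 := congrArg (fun v : L2T n M => WithLp.ofLp v (0 : Tor (fine n M))) h
  simp [oneT] at h0

/-! ## §6 The Gaussian integrals of Sect. C on the torus with the printed R, no free hypothesis -/

/-- **(1.39) on the torus with R = the printed (1.44)**: for every c ≠ 0 and a > 0 there are G′_k,
(Q′_kG′_k²Q′_k*)⁻¹ (`GreenData`) with 𝒢_α(∂*A) = Z_N(α)⁻¹·exp(−‖R∂*A‖²/2α),
R = I − G′_kQ′_k*(Q′_kG′_k²Q′_k*)⁻¹Q′_kG′_k, for EVERY α and ∂*A.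
[cite: Balaban1984PropagatorsI, (1.39) p.24 + (1.44) p.25] -/
theorem calG_torus_eq_R144 {c : ℝ} (hc : c ≠ 0) {a : ℝ} (ha : 0 < a) :
    ∃ (g : L2T n M →ₗ[ℝ] L2T n M) (c₂ : L2B M →ₗ[ℝ] L2B M),
      GreenData (DeltaT n M c) (QT n M) (QsT n M) a g c₂ ∧
      ∀ (α : ℝ) (f : L2T n M), calG (NQ n M) (DeltaT n M c) α f =
        (ZN (NQ n M) (DeltaT n M c) α)⁻¹ * gaussW (L2T n M) α (R144 (QT n M) (QsT n M) g c₂ f) := by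
  obtain ⟨_, g, c₂, _, -, -, hG, -, -, -⟩ := exists_all_torus n M hc ha
  exact ⟨g, c₂, hG, fun α f => calG_eq_R144 hG (DeltaT_symm n M c) (QT_adj n M) α f⟩

/-- **(1.27) = (1.28) = (1.39) on the torus with R = the printed (1.44)** (c ≠ 0, a > 0, α > 0):
exp(−‖∂*A‖²/2α)·(∫_{N(Q′_k)}exp(−‖∂*A − Δλ‖²/2α)dλ)⁻¹ = Z_N(α)⁻¹·exp(−‖R∂*A‖²/2α).
[cite: Balaban1984PropagatorsI, (1.27)-(1.28) p.22 + (1.39) p.24 + (1.44) p.25] -/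
theorem calG_eq_127_torus_R144 {c : ℝ} (hc : c ≠ 0) {a : ℝ} (ha : 0 < a) {α : ℝ} (hα : 0 < α) :
    ∃ (g : L2T n M →ₗ[ℝ] L2T n M) (c₂ : L2B M →ₗ[ℝ] L2B M),
      GreenData (DeltaT n M c) (QT n M) (QsT n M) a g c₂ ∧
      ∀ f : L2T n M, gaussW (L2T n M) α f *
          (∫ x : NQ n M, gaussW (L2T n M) α (f - DeltaT n M c (x : L2T n M)))⁻¹ =
        (ZN (NQ n M) (DeltaT n M c) α)⁻¹ * gaussW (L2T n M) α (R144 (QT n M) (QsT n M) g c₂ f) := by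
  obtain ⟨Δi, g, c₂, _, hΔ, hQ, hG, -, -, -⟩ := exists_all_torus n M hc ha
  exact ⟨g, c₂, hG, fun f => calG_eq_127_printed hΔ hQ (oneT_ne_zero n M) (oneB_ne_zero M) hG hα f⟩

/-- **(1.46) on the torus with R = the printed (1.44)** (c ≠ 0, a > 0), for EVERY function φ in place of δ_R:
∫_{N(Q′_k)} |det(Δ↾_{N(Q′_k)})| φ(R(∂*A − Δλ)) dλ = ∫_R φ.
[cite: Balaban1984PropagatorsI, (1.46) p.26 + (1.44) p.25] -/
theorem integral_146_torus_R144 {c : ℝ} (hc : c ≠ 0) {a : ℝ} (ha : 0 < a) {G : Type*} [NormedAddCommGroup G]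
    [NormedSpace ℝ G] (φ : L2T n M → G) :
    ∃ (g : L2T n M →ₗ[ℝ] L2T n M) (c₂ : L2B M →ₗ[ℝ] L2B M),
      GreenData (DeltaT n M c) (QT n M) (QsT n M) a g c₂ ∧
      ∀ f : L2T n M,
        ∫ x : NQ n M, detN (NQ n M) (DeltaT n M c) • φ (R144 (QT n M) (QsT n M) g c₂ (f - DeltaT n M c x)) =
          ∫ y : Rsub (NQ n M) (DeltaT n M c), φ y := by
  obtain ⟨Δi, g, c₂, _, hΔ, hQ, hG, -, -, -⟩ := exists_all_torus n M hc ha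
  exact ⟨g, c₂, hG, fun f => integral_146_R144 hΔ hQ (oneT_ne_zero n M) (oneB_ne_zero M) hG φ f⟩

/-- (1.39) on the torus with R = the printed (1.38) on arguments ∂*A ⊥ 1 (c ≠ 0): there are Δ⁻¹ (`LapData`) and
(Q′_kΔ⁻²Q′_k*)⁻¹ on 1′^⊥ with 𝒢_α(∂*A) = Z_N(α)⁻¹·exp(−‖R∂*A‖²/2α), R = I − Δ⁻¹Q′_k*(Q′_kΔ⁻²Q′_k*)⁻¹Q′_kΔ⁻¹.
[cite: Balaban1984PropagatorsI, (1.39) p.24 + (1.38) p.24] -/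
theorem calG_torus_eq_R138 {c : ℝ} (hc : c ≠ 0) :
    ∃ (Δi : L2T n M →ₗ[ℝ] L2T n M) (ci : L2B M →ₗ[ℝ] L2B M),
      LapData (oneT n M) (DeltaT n M c) Δi ∧
      (∀ φ : L2B M, inner ℝ (oneB M) φ = 0 → QT n M (Δi (Δi (QsT n M (ci φ)))) = φ) ∧
      ∀ (α : ℝ) (f : L2T n M), inner ℝ (oneT n M) f = 0 → calG (NQ n M) (DeltaT n M c) α f =
        (ZN (NQ n M) (DeltaT n M c) α)⁻¹ * gaussW (L2T n M) α (R138 Δi (QT n M) (QsT n M) ci f) := by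
  obtain ⟨Δi, g, c₂, ci, hΔ, hQ, hG, hci, -, -⟩ := exists_all_torus n M hc one_pos
  exact ⟨Δi, ci, hΔ, hci, fun α f hf =>
    calG_eq_R138 hΔ hQ (oneT_ne_zero n M) (oneB_ne_zero M) hci hG α f hf⟩

/-! ## §7 Weights: the PRINTED adjoint Q′_k* (v1.1; XREAD C-adv6-106 (β))

Print pairs T_η with the η^d-weighted product ⟨u, v⟩ = Σ_x η^d u(x)v(x) ((1.21), η = n⁻¹ here) and T₁^(k) with the
counting product, so the printed Q′_k* is the block-constant extension (Q′_k*φ)(x) = φ(y(x)) = η^{−d}·(Qᵀφ)(x).  §7a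
records, abstractly, how reader A's bundles and the operators (1.38), (1.43), (1.44) behave under qs ↦ t•qs; §7b
defines the printed adjoint `QsW` on the typed torus and restates §5 and §6 with it: the concrete R of
`B5GaussSectC` §7 is (1.44), resp. (1.38) on 1^⊥, written with the PRINTED Q′_k* and the printed a. -/

section Rescale

variable {E F : Type*} [NormedAddCommGroup E] [InnerProductSpace ℝ E] [NormedAddCommGroup F]
  [InnerProductSpace ℝ F]
variable {Δ Δi g : E →ₗ[ℝ] E} {q : E →ₗ[ℝ] F} {qs : F →ₗ[ℝ] E} {c₂ ci : F →ₗ[ℝ] F} {a t : ℝ} {one' : F}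

/-- Rescaling the adjoint rescales a and (Q′_kG′_k²Q′_k*)⁻¹: Δ + a(tQ′_k*)Q′_k = Δ + (ta)Q′_k*Q′_k has the same
G′_k, and Q′_kG′_k²(tQ′_k*) = t·Q′_kG′_k²Q′_k*. [folklore] -/
theorem greenData_rescale (h : GreenData Δ q (t • qs) a g c₂) : GreenData Δ q qs (t * a) g (t • c₂) where
  g_left x := by simpa [smul_smul, mul_comm] using h.g_left x
  g_right x := by simpa [smul_smul, mul_comm] using h.g_right x
  c_left φ := by simpa [map_smul] using h.c_left φ
  c_right φ := by simpa [map_smul] using h.c_right φ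

/-- … and conversely for t ≠ 0. [folklore] -/
theorem greenData_unrescale (ht : t ≠ 0) (h : GreenData Δ q qs (t * a) g c₂) :
    GreenData Δ q (t • qs) a g (t⁻¹ • c₂) where
  g_left x := by simpa [smul_smul, mul_comm] using h.g_left x
  g_right x := by simpa [smul_smul, mul_comm] using h.g_right x
  c_left φ := by
    simp only [LinearMap.smul_apply, map_smul, smul_smul]
    rw [mul_inv_cancel₀ ht, one_smul]
    exact h.c_left φ
  c_right φ := by
    simp only [LinearMap.smul_apply, map_smul, smul_smul]
    rw [inv_mul_cancel₀ ht, one_smul]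
    exact h.c_right φ

/-- I − R of (1.44) under qs ↦ t•qs: the factor moves into (Q′_kG′_k²Q′_k*)⁻¹. [folklore] -/
theorem P144_rescale : P144 q (t • qs) g c₂ = P144 q qs g (t • c₂) := by
  ext x
  simp only [P144_apply, LinearMap.smul_apply, map_smul]

/-- R of (1.44) under qs ↦ t•qs. [folklore] -/
theorem R144_rescale : R144 q (t • qs) g c₂ = R144 q qs g (t • c₂) := by
  rw [R144, R144, P144_rescale]

/-- λ₀ of (1.43) under qs ↦ t•qs. [folklore] -/
theorem lambda0_rescale : lambda0 q (t • qs) g c₂ = lambda0 q qs g (t • c₂) := by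
  ext f
  simp only [lambda0_apply, LinearMap.smul_apply, map_smul]

/-- I − R of (1.38) under qs ↦ t•qs: the factor moves into (Q′_kΔ⁻²Q′_k*)⁻¹. [folklore] -/
theorem P138_rescale : P138 Δi q (t • qs) ci = P138 Δi q qs (t • ci) := by
  ext x
  simp only [P138_apply, LinearMap.smul_apply, map_smul]

/-- R of (1.38) under qs ↦ t•qs. [folklore] -/
theorem R138_rescale : R138 Δi q (t • qs) ci = R138 Δi q qs (t • ci) := by
  rw [R138, R138, P138_rescale]

/-- The right-inverse hypothesis on (Q′_kΔ⁻²Q′_k*)⁻¹ (p. 22, on 1′^⊥) under qs ↦ t•qs. [folklore] -/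
theorem rightInv138_rescale :
    (∀ φ : F, inner ℝ one' φ = 0 → q (Δi (Δi ((t • qs) (ci φ)))) = φ) ↔
      ∀ φ : F, inner ℝ one' φ = 0 → q (Δi (Δi (qs ((t • ci) φ)))) = φ := by
  simp only [LinearMap.smul_apply, map_smul]

variable [FiniteDimensional ℝ E]

/-- `B5GaussSectCR144.Rop_eq_R144` with a rescaled adjoint: the orthogonal projection onto ΔN(Q′_k) is (1.44)
written with ANY multiple t•Q′_k* of the adjoint (G′_k, (Q′_kG′_k²Q′_k*)⁻¹ taken for that multiple).
[cite: Balaban1984PropagatorsI, (1.44)+p.25 ll.2-5] -/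
theorem Rop_eq_R144_rescaled (hG : GreenData Δ q (t • qs) a g c₂)
    (hΔs : ∀ x y : E, inner ℝ (Δ x) y = inner ℝ x (Δ y))
    (hadj : ∀ (x : E) (φ : F), inner ℝ (q x) φ = inner ℝ x (qs φ)) (f : E) :
    Rop (LinearMap.ker q) Δ f = R144 q (t • qs) g c₂ f := by
  rw [R144_rescale]
  exact Rop_eq_R144 (greenData_rescale hG) hΔs hadj f

end Rescale

/-! ### §7b The printed adjoint on the typed torus -/

/-- The PRINTED Q′_k*: the adjoint of Q′_k (1.20) for the η^d-weighted product on T_η and the counting product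
on T₁^(k), = η^{−d}·Qᵀ = n^d·`QsT`. [cite: Balaban1984PropagatorsI, (1.20) p.20 + (1.21) p.21 + p.22] -/
def QsW : L2B M →ₗ[ℝ] L2T n M := ((n : ℝ) ^ d) • QsT n M

omit [NeZero n] in
/-- Unfolding of `QsW`. [folklore] -/
theorem ofLp_QsW (φ : L2B M) :
    WithLp.ofLp (QsW n M φ) = ((n : ℝ) ^ d) • ((reM (QsOp n M))ᵀ *ᵥ WithLp.ofLp φ) := by
  rw [QsW, LinearMap.smul_apply, WithLp.ofLp_smul, ofLp_QsT]

omit [NeZero n] in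
/-- The real transpose acts as the real part of the conjugate transpose on real vectors. [folklore] -/
theorem transpose_reM_mulVec (Q : Matrix (Tor M) (Tor (fine n M)) ℂ) (u : Tor M → ℝ) (x : Tor (fine n M)) :
    ((reM Q)ᵀ *ᵥ u) x = ((Qᴴ *ᵥ cplx u) x).re := by
  simp [Matrix.mulVec, dotProduct, reM, Matrix.transpose_apply, Matrix.conjTranspose_apply, Complex.re_sum]

/-- η^d = n^{−d} ≠ 0. [folklore] -/
theorem npow_ne_zero : ((n : ℝ) ^ d) ≠ 0 := pow_ne_zero _ (Nat.cast_ne_zero.mpr (NeZero.ne n))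

/-- `QsW` IS the printed adjoint: (Q′_k*φ)(x) = φ(y(x)), the block-constant extension (via
`B5Adjoint130.QsOp_adjoint_mulVec`). [cite: Balaban1984PropagatorsI, (1.20) p.20 + p.22] -/
theorem QsW_apply (φ : L2B M) (x : Tor (fine n M)) :
    WithLp.ofLp (QsW n M φ) x = WithLp.ofLp φ (B5Blocks16.blockOf n M x) := by
  rw [ofLp_QsW, Pi.smul_apply, transpose_reM_mulVec, B5Adjoint130.QsOp_adjoint_mulVec, smul_eq_mul,
    cplx_apply]
  have h1 : (1 / (n : ℂ) ^ d * ((WithLp.ofLp φ (B5Blocks16.blockOf n M x) : ℝ) : ℂ)) =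
      (((1 / (n : ℝ) ^ d) * WithLp.ofLp φ (B5Blocks16.blockOf n M x) : ℝ) : ℂ) := by
    push_cast; ring
  rw [h1, Complex.ofReal_re, ← mul_assoc, mul_one_div_cancel (npow_ne_zero n), one_mul]

/-- Q′_k is the adjoint of `QsW` for the WEIGHTED product: Σ_y (Q′_kf)(y)φ(y) = Σ_x η^d f(x)(Q′_k*φ)(x).
[cite: Balaban1984PropagatorsI, p.22] -/
theorem QT_adj_weighted (f : L2T n M) (φ : L2B M) :
    inner ℝ (QT n M f) φ = ((n : ℝ) ^ d)⁻¹ * inner ℝ f (QsW n M φ) := by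
  rw [QT_adj, QsW, LinearMap.smul_apply, inner_smul_right, ← mul_assoc, inv_mul_cancel₀ (npow_ne_zero n),
    one_mul]

/-- Q′_kQ′_k* = I for the printed adjoint (the block average of a block-constant function is that function).
[folklore] -/
theorem QT_QsW (φ : L2B M) : QT n M (QsW n M φ) = φ := by
  apply WithLp.ofLp_injective 2
  funext y
  have hre : ∀ u : Tor (fine n M) → ℝ, (reM (QsOp n M) *ᵥ u) y = ((QsOp n M *ᵥ cplx u) y).re := by
    intro u
    rw [← (B5RealFields.isReal_QsOp n M).cplx_mulVec u, cplx_apply, Complex.ofReal_re]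
  rw [ofLp_QT, hre, B5Block118.QsOp_mulVec]
  simp only [cplx_apply, QsW_apply, B5Blocks16.blockOf_bpt, Finset.sum_const, Finset.card_univ,
    Fintype.card_fun, Fintype.card_fin, nsmul_eq_mul]
  have h1 : (1 / (n : ℂ) ^ d * (((n ^ d : ℕ) : ℂ) * ((WithLp.ofLp φ y : ℝ) : ℂ))) =
      ((WithLp.ofLp φ y : ℝ) : ℂ) := by
    have hn : ((n : ℂ)) ^ d ≠ 0 := pow_ne_zero _ (Nat.cast_ne_zero.mpr (NeZero.ne n))
    push_cast
    field_simp
  rw [h1, Complex.ofReal_re]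

/-- §5 with the printed adjoint, ∀-form (no c ≠ 0 needed): for EVERY G′_k, (Q′_kG′_k²Q′_k*)⁻¹ satisfying
`GreenData` for Δ′_a = Δ + aQ′_k*Q′_k with the PRINTED Q′_k*, the orthogonal projection onto ΔN(Q′_k) of
`B5GaussSectC` §7 is the printed (1.44). [cite: Balaban1984PropagatorsI, (1.44)+p.25 ll.2-5] -/
theorem Rop_torus_eq_R144_printedAdjoint {c a : ℝ} {g : L2T n M →ₗ[ℝ] L2T n M} {c₂ : L2B M →ₗ[ℝ] L2B M}
    (hG : GreenData (DeltaT n M c) (QT n M) (QsW n M) a g c₂) (f : L2T n M) :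
    Rop (NQ n M) (DeltaT n M c) f = R144 (QT n M) (QsW n M) g c₂ f :=
  Rop_eq_R144_rescaled hG (DeltaT_symm n M c) (QT_adj n M) f

/-- The same ∀-form for the typed (transpose) adjoint of v1 (XREAD C-adv6-106 I2: §5's ∃ is a ∀, G′_k being
unique). [cite: Balaban1984PropagatorsI, (1.44)+p.25 ll.2-5] -/
theorem Rop_torus_eq_R144_of_greenData {c a : ℝ} {g : L2T n M →ₗ[ℝ] L2T n M} {c₂ : L2B M →ₗ[ℝ] L2B M}
    (hG : GreenData (DeltaT n M c) (QT n M) (QsT n M) a g c₂) (f : L2T n M) :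
    Rop (NQ n M) (DeltaT n M c) f = R144 (QT n M) (QsT n M) g c₂ f :=
  Rop_eq_R144 hG (DeltaT_symm n M c) (QT_adj n M) f

/-- §5 with the printed adjoint, ∃-form: for c ≠ 0 and every printed a > 0, G′_k = (Δ + aQ′_k*Q′_k)⁻¹ and
(Q′_kG′_k²Q′_k*)⁻¹ with the PRINTED Q′_k* exist and R = (1.44). [cite: Balaban1984PropagatorsI, (1.44) p.25] -/
theorem exists_R144_printedAdjoint {c : ℝ} (hc : c ≠ 0) {a : ℝ} (ha : 0 < a) :
    ∃ (g : L2T n M →ₗ[ℝ] L2T n M) (c₂ : L2B M →ₗ[ℝ] L2B M),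
      GreenData (DeltaT n M c) (QT n M) (QsW n M) a g c₂ ∧
      ∀ f : L2T n M, Rop (NQ n M) (DeltaT n M c) f = R144 (QT n M) (QsW n M) g c₂ f := by
  have hn : (0 : ℝ) < (n : ℝ) ^ d := pow_pos (Nat.cast_pos.mpr (Nat.pos_of_ne_zero (NeZero.ne n))) _
  obtain ⟨_, g, c₂, _, -, -, hG, -, -, -⟩ := exists_all_torus n M hc (mul_pos hn ha)
  have hG' : GreenData (DeltaT n M c) (QT n M) (QsW n M) a g (((n : ℝ) ^ d)⁻¹ • c₂) :=
    greenData_unrescale hn.ne' hG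
  exact ⟨g, _, hG', fun f => Rop_torus_eq_R144_printedAdjoint n M hG' f⟩

/-- (1.39) with R = (1.44) in the printed adjoint: 𝒢_α(f) = Z_N(α)⁻¹·exp(−‖Rf‖²/2α).
[cite: Balaban1984PropagatorsI, (1.39) p.24 + (1.44) p.25] -/
theorem calG_torus_eq_R144_printedAdjoint {c a : ℝ} {g : L2T n M →ₗ[ℝ] L2T n M} {c₂ : L2B M →ₗ[ℝ] L2B M}
    (hG : GreenData (DeltaT n M c) (QT n M) (QsW n M) a g c₂) (α : ℝ) (f : L2T n M) :
    calG (NQ n M) (DeltaT n M c) α f =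
      (ZN (NQ n M) (DeltaT n M c) α)⁻¹ * gaussW (L2T n M) α (R144 (QT n M) (QsW n M) g c₂ f) := by
  rw [calG, Rop_torus_eq_R144_printedAdjoint n M hG f]

/-- §5 / (1.38) with the printed adjoint (c ≠ 0): Δ⁻¹ (`LapData`) and a right inverse (Q′_kΔ⁻²Q′_k*)⁻¹ on 1′^⊥ for
the PRINTED Q′_k* exist, and on arguments ⊥ 1 the orthogonal projection onto ΔN(Q′_k) is the printed (1.38).
[cite: Balaban1984PropagatorsI, (1.38) p.24] -/
theorem exists_R138_printedAdjoint {c : ℝ} (hc : c ≠ 0) :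
    ∃ (Δi : L2T n M →ₗ[ℝ] L2T n M) (ci : L2B M →ₗ[ℝ] L2B M),
      LapData (oneT n M) (DeltaT n M c) Δi ∧
      (∀ φ : L2B M, inner ℝ (oneB M) φ = 0 → QT n M (Δi (Δi (QsW n M (ci φ)))) = φ) ∧
      ∀ f : L2T n M, inner ℝ (oneT n M) f = 0 →
        Rop (NQ n M) (DeltaT n M c) f = R138 Δi (QT n M) (QsW n M) ci f := by
  obtain ⟨Δi, g, c₂, ci, hΔ, -, -, hci, -, hR⟩ := exists_all_torus n M hc one_pos
  refine ⟨Δi, (((n : ℝ) ^ d)⁻¹) • ci, hΔ, fun φ hφ => ?_, fun f hf => ?_⟩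
  · have h2 : QsW n M ((((n : ℝ) ^ d)⁻¹ • ci) φ) = QsT n M (ci φ) := by
      rw [LinearMap.smul_apply, map_smul, QsW, LinearMap.smul_apply, smul_smul,
        inv_mul_cancel₀ (npow_ne_zero n), one_smul]
    rw [h2]
    exact hci φ hφ
  · rw [hR f hf, QsW, R138_rescale, smul_smul, mul_inv_cancel₀ (npow_ne_zero n), one_smul]

end Literature.MathematicalPhysics.QuantumFieldTheory.Balaban1983to89.B5Projector144Torus
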